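import Mathlib
import HarnessLib
import Literature.Combinatorics.Additive.StepBeyondKempermanLift
import Literature.Combinatorics.Additive.StepBeyondKempermanPeriodic
import Literature.Combinatorics.Additive.KempermanStructureTheoremNecessity

/-!
# Grynkiewicz 2009, §6 Claim 4: Theorem 4.1 reduces to non-quasi-periodic summands

[cite: Grynkiewicz2009, §6 Claim 4 (proof of Thm 4.1)] [tag: critical-pair] [tag: inverse-theorem]

Topic `Literature/Combinatorics/Additive`.  Cell `mm-stpp` (D-0046), seat `mm-stpp-lit` (gen 23); the
port of D. J. Grynkiewicz, *A step beyond Kemperman's structure theorem*, Mathematika **55** (2009)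
67–114 continued.  §6, **Claim 4** (print p. 24): «It suffices to prove Theorem 4.1 in the case both
`A` and `B` are non-quasi-periodic sets with `⟨A⟩ = ⟨B⟩ = G`.  In view of Claim 1 and previous
assumptions, the hypotheses of Lemma 5.3 hold for `A` and `B`.  However, it is readily checked that if
`A = A₁ ∪ A₀` and `B = B₁ ∪ B₀` are quasi-periodic decompositions satisfying the conclusion of Lemma 5.3,
and if Theorem 4.1 holds for the pair `(A₀, B₀)`, then Theorem 4.1 holds for the pair `(A, B)`.  Thus
it follows in view of Lemma 5.3 (by considering reduced quasi-periodic decompositions) that it suffices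
to prove the theorem when neither `A` nor `B` is quasi-periodic …»

This file proves the first half of Claim 4 — THE REDUCTION TO NON-QUASI-PERIODIC SUMMANDS — for an
arbitrary abelian group `G`:
* `Grynkiewicz2009.conclusion_of_coarse` — «if … quasi-periodic decompositions satisfying the
  conclusion of Lemma 5.3, and if Theorem 4.1 holds for the pair `(A₀, B₀)`, then Theorem 4.1 holds
  for the pair `(A, B)`»: BOTH alternatives of the conclusion of Theorem 4.1 (first part) —
  (17) `∃ α β, |(A ∪ {α}) + (B ∪ {β})| = |A ∪ {α}| + |B ∪ {β}| − 1`, or a decomposition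
  `IsGrynkiewiczDecomp` — pass from the bottom pair of Lemma 5.3's data to `(A, B)`.  The lifts of
  `StepBeyondKempermanLift.lean` (`seventeen_of_coarse` for holes in the cosets of `A₀`, `B₀`;
  `IsGrynkiewiczDecomp.lift` for a quasi-period `K ≤ H`) are completed here by the two checks the
  print leaves to the reader: a hole of (17) for `(A₀, B₀)` outside the coset of `A₀` is impossible
  (it would add a whole translate of `B₀`, `|B₀| ≥ 2`, to the sum: `sub_mem_of_seventeen`), a «hole»
  inside `A₀` means `A₀ + β ⊆ A₀ + B₀` and then `A + β ⊆ A + B` (`seventeen_lift_of_mem`); and a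
  decomposition of `(A₀, B₀)` with empty periodic parts is replaced by Lemma 5.3's own data
  (`IsGrynkiewiczDecomp.of_coarse`), otherwise its quasi-period lies in `H`.
* `Grynkiewicz2009.cosetCount_add_of_splitting` — condition (ii) of Lemma 5.3,
  `|φ_H(A + B)| = |φ_H(A)| + |φ_H(B)| − 1`, in the coset-count form used by `IsGrynkiewiczDecomp`, read
  off the tree's rendering of Lemma 5.3 (`exists_isQuasiPeriodicDecomp_of_isQuasiPeriodicDecomp`:
  the splitting `A + B = (A₁ + B) ⊔ (A₀ + B₀)` and display (27)); `exists_coarse_of_isQuasiPeriodic`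
  packages Lemma 5.3 for a quasi-periodic `A` (after enlarging the quasi-period to the maximal period
  `H(A₁)` of the periodic part, as in the print's second paragraph).
* `Grynkiewicz2009.conclusion_of_forall_not_isQuasiPeriodic` — **CLAIM 4, first half**: if the
  conclusion of Theorem 4.1 holds for every pair of nonempty, NON-QUASI-PERIODIC, mutually
  non-extendible finite sets `A, B ⊆ G` with `|A + B| = |A| + |B|` and `A + B` aperiodic, then it
  holds for every pair of nonempty finite sets with `|A + B| = |A| + |B|` and `A + B` aperiodic.
  DEVIATION (bookkeeping only): the print reaches a pair of REDUCED quasi-periodic decompositions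
  satisfying Lemma 5.3 in one step (second paragraph of Claim 4); we instead iterate — a strong
  induction on `|A| + |B|`: an extendible pair satisfies (17) outright
  (`seventeen_of_insert_add_eq`), a quasi-periodic `A` (or `B`, by symmetry) is handled by Lemma 5.3,
  whose bottom pair `(A₀, B₀)` again satisfies the hypotheses of Theorem 4.1 (`|A₀ + B₀| = |A₀| + |B₀|`
  is Lemma 5.3 (iii); `A₀ + B₀` is aperiodic by `not_isPeriodic_bottom_of_coarse`) with
  `|A₀| + |B₀| < |A| + |B|`, and `conclusion_of_coarse` lifts its conclusion.  The notion «reduced» is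
  therefore not needed.
Not here (second half of Claim 4, «w.l.o.g. `⟨A⟩ = ⟨B⟩ = G`», Lemma 5.2 plus the passage to the
subgroup `⟨A⟩`): the transport of the conclusion of Theorem 4.1 from a subgroup type to `G`.

MAIN RESULTS (0 definitions, 0 named facts; everything PROVED): `conclusion_of_coarse`,
`conclusion_of_forall_not_isQuasiPeriodic`; also `conclusion_symm`, `cosetCount_add_of_splitting`,
`exists_coarse_of_isQuasiPeriodic`, `seventeen_lift`, `exists_isGrynkiewiczDecomp_of_coarse`
(`cosetCount_add_carrier` is reused from `KempermanStructureTheoremNecessity.lean`).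

## References
* D. J. Grynkiewicz, *A step beyond Kemperman's structure theorem*, Mathematika 55 (2009) 67–114,
  doi:10.1112/S0025579300000966, §6 Claim 4 (p. 24), Lemma 5.3 (p. 15), Thm 4.1 (p. 10)
  [cite: Grynkiewicz2009, Thm 4.1 (proof, Claim 4)] — held `paper:doi-10-1112-s0025579300000966`,
  p0024 read 2026-08-29.
-/

namespace Literature.Combinatorics.Additive

open Finset
open scoped Pointwise

universe u

variable {G : Type u} [AddCommGroup G] [DecidableEq G]

namespace Grynkiewicz2009

/-! ### The conclusion of Theorem 4.1 is symmetric in `A` and `B` -/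

/-- (17) for `(A, B)` gives (17) for `(B, A)`. [cite: Grynkiewicz2009, Thm 4.1 (display (17))] -/
theorem seventeen_symm {A B : Finset G}
    (h : ∃ α β : G, #(insert α A + insert β B) + 1 = #(insert α A) + #(insert β B)) :
    ∃ α β : G, #(insert α B + insert β A) + 1 = #(insert α B) + #(insert β A) := by
  obtain ⟨α, β, h⟩ := h
  refine ⟨β, α, ?_⟩
  rw [add_comm (insert β B), add_comm #(insert β B)]
  exact h

/-- The conclusion of Theorem 4.1 (first part) for `(A, B)` gives it for `(B, A)`.
[cite: Grynkiewicz2009, Thm 4.1] -/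
theorem conclusion_symm {A B : Finset G}
    (h : (∃ α β : G, #(insert α A + insert β B) + 1 = #(insert α A) + #(insert β B)) ∨
      ∃ (K : AddSubgroup G) (A₁ A₀ B₁ B₀ : Finset G), IsGrynkiewiczDecomp K A B A₁ A₀ B₁ B₀) :
    (∃ α β : G, #(insert α B + insert β A) + 1 = #(insert α B) + #(insert β A)) ∨
      ∃ (K : AddSubgroup G) (B₁ B₀ A₁ A₀ : Finset G), IsGrynkiewiczDecomp K B A B₁ B₀ A₁ A₀ := by
  rcases h with h | ⟨K, A₁, A₀, B₁, B₀, hK⟩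
  · exact Or.inl (seventeen_symm h)
  · exact Or.inr ⟨K, B₁, B₀, A₁, A₀, hK.symm⟩

/-! ### Lemma 5.3 (ii) in coset-count form -/

/-- **Lemma 5.3 (ii), coset-count form.**  From the tree's rendering of Lemma 5.3 — the splitting
`A + B = (A₁ + B) ⊔ (A₀ + B₀)` with `A₁ + B` `H`-periodic and `A₀ + B₀` inside one `H`-coset, and
display (27) `|A₁ + B| + |H| = |A₁| + |B + H|` (`H = H(A₁)`) — read off
`|φ_H(A + B)| = |φ_H(A)| + |φ_H(B)| − 1`: the coset of `A₀ + B₀` is a new one, and (27) divided by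
`|H|` is `|φ_H(A₁ + B)| + 1 = |φ_H(A₁)| + |φ_H(B)|`. [cite: Grynkiewicz2009, Lemma 5.3 (ii), (27)–(28)] -/
theorem cosetCount_add_of_splitting {H : AddSubgroup G} {A B A₁ A₀ B₀ : Finset G}
    (hdA : IsQuasiPeriodicDecomp H A A₁ A₀) (hHA₁ : (H : Set G) = (A₁.addStab : Set G))
    (hA₀ : A₀.Nonempty) (hB₀ : B₀.Nonempty) (hB₀H : ∀ x ∈ B₀, ∀ y ∈ B₀, x - y ∈ H)
    (hsplit : A + B = (A₁ + B) ∪ (A₀ + B₀)) (hdisj : Disjoint (A₁ + B) (A₀ + B₀))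
    (h27 : #(A₁ + B) + #A₁.addStab = #A₁ + #(B + A₁.addStab)) :
    cosetCount H (A + B) + 1 = cosetCount H A + cosetCount H B := by
  classical
  have hHf : ∀ g, g ∈ A₁.addStab ↔ g ∈ H := fun g => by
    rw [← mem_coe, ← hHA₁, SetLike.mem_coe]
  have hper1 : IsPeriodicWith H (A₁ + B) := hdA.periodic.add_right B
  -- the coset of `A₀ + B₀` is not met by `A₁ + B`
  have hsep : ∀ x ∈ A₁ + B, ∀ y ∈ A₀ + B₀, x - y ∉ H := by
    intro x hx y hy hxy
    have : y ∈ A₁ + B := by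
      have := hper1.add_mem (H.neg_mem hxy) hx
      rwa [neg_sub, sub_add_cancel] at this
    exact disjoint_left.1 hdisj this hy
  have hone : ∀ x ∈ A₀ + B₀, ∀ y ∈ A₀ + B₀, x - y ∈ H := by
    intro x hx y hy
    obtain ⟨a, ha, b, hb, rfl⟩ := mem_add.1 hx
    obtain ⟨a', ha', b', hb', rfl⟩ := mem_add.1 hy
    rw [add_sub_add_comm]
    exact H.add_mem (hdA.sub_mem a ha a' ha') (hB₀H b hb b' hb')
  have h1 : cosetCount H (A + B) = cosetCount H (A₁ + B) + 1 := by
    rw [hsplit, cosetCount_union hsep, cosetCount_eq_one_of_sub_mem (hA₀.add hB₀) hone]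
  -- (27) divided by `|H|`
  have hc1 := card_eq_cosetCount_mul hHf hper1
  have hcA₁ := card_eq_cosetCount_mul hHf hdA.periodic
  have hcB := card_eq_cosetCount_mul hHf (isPeriodicWith_add_of_forall_mem_iff hHf B)
  rw [cosetCount_add_carrier hHf] at hcB
  have hpos : 0 < #A₁.addStab := card_pos.2 ⟨0, (hHf 0).2 H.zero_mem⟩
  have h2 : cosetCount H (A₁ + B) + 1 = cosetCount H A₁ + cosetCount H B := by
    apply Nat.eq_of_mul_eq_mul_right hpos
    rw [add_mul, add_mul, one_mul, ← hc1, ← hcA₁, ← hcB]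
    exact h27
  rw [h1, hdA.cosetCount_eq hA₀]
  omega

/-- **Lemma 5.3 packaged for Claim 4.**  For a quasi-periodic `A` and the hypotheses of Lemma 5.3
(`B ≠ ∅`, `|A + B| = |A| + |B|`, `A + B` aperiodic, `(A, B)` non-extendible): coarse data relative to
the (finite) maximal period `H = H(A₁)` of the periodic part — quasi-periodic decompositions
`A = A₁ ∪ A₀`, `B = B₁ ∪ B₀`, `A₁, A₀, B₀ ≠ ∅`, (iii) `|A₀ + B₀| = |A₀| + |B₀|`, (i) (elementwise)
and (ii) (coset counts).  «Let `A = A₁ ∪ A₀` be a … quasi-periodic decomposition with `H = H(A₁)`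
and apply Lemma 5.3.» [cite: Grynkiewicz2009, Lemma 5.3; §6 Claim 4] -/
theorem exists_coarse_of_isQuasiPeriodic {A B : Finset G} (hAqp : IsQuasiPeriodic A)
    (hBne : B.Nonempty) (hAB : #(A + B) = #A + #B) (haper : (A + B).addStab = {0})
    (hA : IsNonExtendible A B) (hB : IsNonExtendible B A) :
    ∃ (H : AddSubgroup G) (Hf A₁ A₀ B₁ B₀ : Finset G), (∀ g, g ∈ Hf ↔ g ∈ H) ∧
      IsQuasiPeriodicDecomp H A A₁ A₀ ∧ IsQuasiPeriodicDecomp H B B₁ B₀ ∧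
      A₁.Nonempty ∧ A₀.Nonempty ∧ B₀.Nonempty ∧ #(A₀ + B₀) = #A₀ + #B₀ ∧
      (∀ a ∈ A, ∀ b ∈ B, ∀ x ∈ A₀, ∀ y ∈ B₀, (a + b) - (x + y) ∈ H → a - x ∈ H ∧ b - y ∈ H) ∧
      cosetCount H (A + B) + 1 = cosetCount H A + cosetCount H B := by
  classical
  obtain ⟨K, A₁, A₀, hdecK, hA₁ne⟩ := hAqp
  -- pass to the maximal period `H = H(A₁)` of the periodic part
  let H : AddSubgroup G := AddAction.stabilizer G A₁
  have hmemH : ∀ g, g ∈ H ↔ g +ᵥ A₁ = A₁ := fun g => AddAction.mem_stabilizer_iff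
  have hHset : (H : Set G) = (A₁.addStab : Set G) := by
    ext g; rw [SetLike.mem_coe, hmemH, mem_coe, mem_addStab hA₁ne]
  have hHf : ∀ g, g ∈ A₁.addStab ↔ g ∈ H := fun g => by
    rw [mem_addStab hA₁ne, hmemH]
  have hKH : K ≤ H := fun k hk => (hmemH k).2 (hdecK.periodic k hk)
  have hdA : IsQuasiPeriodicDecomp H A A₁ A₀ :=
    ⟨fun h => hdecK.ne_bot (le_bot_iff.1 (h ▸ hKH)), hdecK.disjoint, hdecK.union_eq,
      fun h hh => (hmemH h).1 hh, fun x hx y hy => hKH (hdecK.sub_mem x hx y hy)⟩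
  obtain ⟨B₁, B₀, hdB, hA₀ne, hB₀ne, hiii, hsplit, hdisj, h27, hi⟩ :=
    exists_isQuasiPeriodicDecomp_of_isQuasiPeriodicDecomp hdA hA₁ne hHset hBne hAB haper hA hB
  refine ⟨H, A₁.addStab, A₁, A₀, B₁, B₀, hHf, hdA, hdB, hA₁ne, hA₀ne, hB₀ne, hiii, ?_,
    cosetCount_add_of_splitting hdA hHset hA₀ne hB₀ne hdB.sub_mem hsplit hdisj h27⟩
  intro a ha b hb x hx y hy hq
  obtain ⟨ha₀, hb₀⟩ := hi a ha b hb x hx y hy hq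
  exact ⟨hdA.sub_mem a ha₀ x hx, hdB.sub_mem b hb₀ y hy⟩

/-! ### Lifting (17) from the bottom pair: the general hole positions -/

/-- `|A' + B'| = |A'| + |B'|` with `B' ≠ ∅` forces `|B'| ≥ 2` («if `|A| = 1`, then `|A + B| = |A| + |B|`
cannot hold», Claim 3). [cite: Grynkiewicz2009, §6 Claim 3] -/
theorem two_le_card_right {A' B' : Finset G} (hB' : B'.Nonempty) (h : #(A' + B') = #A' + #B') :
    2 ≤ #B' := by
  by_contra hlt
  have h1 : #B' = 1 := by have := hB'.card_pos; omega
  obtain ⟨b, rfl⟩ := card_eq_one.1 h1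
  rw [card_add_singleton, card_singleton] at h
  omega

/-- A «hole» of (17) for the bottom pair lying inside `A'` (so only `β ∉ B'` is added): then
`A' + β ⊆ A' + B'`, `β` lies in the coset of `B'`, and `A + β ⊆ A + B`, which is (17) for `(A, B)`
with the same `α ∈ A`, `β`. [cite: Grynkiewicz2009, §6 Claim 4 («it is readily checked …»)] -/
theorem seventeen_lift_of_mem {H : AddSubgroup G} {A B A₁ A' B₁ B' : Finset G} {α β : G}
    (hdA : IsQuasiPeriodicDecomp H A A₁ A') (hdB : IsQuasiPeriodicDecomp H B B₁ B')
    (hB' : B'.Nonempty) (hAB : #(A + B) = #A + #B) (hA'B' : #(A' + B') = #A' + #B')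
    (hα : α ∈ A') (hβ : β ∉ B')
    (h17 : #(insert α A' + insert β B') + 1 = #(insert α A') + #(insert β B')) :
    #(insert α A + insert β B) + 1 = #(insert α A) + #(insert β B) := by
  rw [insert_eq_of_mem hα, card_insert_of_notMem hβ] at h17
  -- `A' + (B' ∪ {β}) = A' + B'`
  have hsub : A' + B' ⊆ A' + insert β B' := add_subset_add_left (subset_insert _ _)
  have heq : A' + insert β B' = A' + B' := (eq_of_subset_of_card_le hsub (by omega)).symm
  -- `β` lies in the coset of `B'`
  obtain ⟨b', hb'⟩ := hB'
  have hβH : β - b' ∈ H := by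
    have : α + β ∈ A' + B' := by rw [← heq]; exact add_mem_add hα (mem_insert_self _ _)
    obtain ⟨x, hx, y, hy, hxy⟩ := mem_add.1 this
    have e : β - b' = (x - α) + (y - b') := by
      have : β = x + y - α := by rw [hxy]; abel
      rw [this]; abel
    rw [e]; exact H.add_mem (hdA.sub_mem x hx α hα) (hdB.sub_mem y hy b' hb')
  have hβB : β ∉ B := fun h => by
    rw [← hdB.union_eq, mem_union] at h
    exact h.elim (fun h1 => hdB.sub_notMem h1 hb' hβH) hβ
  rw [insert_eq_of_mem (hdA.right_subset hα), card_insert_of_notMem hβB]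
  -- `A + (B ∪ {β}) = A + B`
  have heq2 : A + insert β B = A + B := by
    refine Subset.antisymm ?_ (add_subset_add_left (subset_insert _ _))
    intro z hz
    obtain ⟨a, ha, y, hy, rfl⟩ := mem_add.1 hz
    rw [mem_insert] at hy
    rcases hy with rfl | hy
    · have ha' := ha
      rw [← hdA.union_eq, mem_union] at ha'
      rcases ha' with ha' | ha'
      · -- `a ∈ A₁`: `a + β = (β − b') + (a + b') ∈ A₁ + B`
        have e : a + y = (y - b') + (a + b') := by abel
        rw [e]
        exact add_subset_add_right hdA.left_subset
          ((hdA.periodic.add_right B).add_mem hβH (add_mem_add ha' (hdB.right_subset hb')))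
      · have : a + y ∈ A' + B' := by rw [← heq]; exact add_mem_add ha' (mem_insert_self _ _)
        exact add_subset_add hdA.right_subset hdB.right_subset this
    · exact add_mem_add ha hy
  rw [heq2, hAB]
  omega

/-- Both holes of (17) for the bottom pair outside `A'`, `B'`: then the hole `α` lies in the coset
`A' + H` — otherwise `α + B'` is a whole new translate of `B'` (`|B'| ≥ 2`) inside
`(A' ∪ {α}) + (B' ∪ {β})`, which has only `|A' + B'| + 1` elements.
[cite: Grynkiewicz2009, §6 Claim 4 («it is readily checked …»)] -/
theorem sub_mem_of_seventeen {H : AddSubgroup G} {A' B' : Finset G} {α β a' : G}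
    (hA'H : ∀ x ∈ A', ∀ y ∈ A', x - y ∈ H) (hB'H : ∀ x ∈ B', ∀ y ∈ B', x - y ∈ H)
    (h2 : 2 ≤ #B') (ha' : a' ∈ A') (hα : α ∉ A') (hβ : β ∉ B')
    (hA'B' : #(A' + B') = #A' + #B')
    (h17 : #(insert α A' + insert β B') + 1 = #(insert α A') + #(insert β B')) : α - a' ∈ H := by
  by_contra hαH
  rw [card_insert_of_notMem hα, card_insert_of_notMem hβ] at h17
  have hdisj : Disjoint (A' + B') (α +ᵥ B') := by
    rw [disjoint_left]
    intro z hz hz'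
    obtain ⟨x, hx, y, hy, rfl⟩ := mem_add.1 hz
    obtain ⟨y', hy', he⟩ := mem_vadd_finset.1 hz'
    rw [vadd_eq_add] at he
    apply hαH
    have e : α - a' = (x - a') + (y - y') := by
      have : α = x + y - y' := by rw [← he]; abel
      rw [this]; abel
    rw [e]; exact H.add_mem (hA'H x hx a' ha') (hB'H y hy y' hy')
  have hsub : (A' + B') ∪ (α +ᵥ B') ⊆ insert α A' + insert β B' := by
    apply union_subset
    · exact add_subset_add (subset_insert _ _) (subset_insert _ _)
    · intro z hz
      obtain ⟨y, hy, rfl⟩ := mem_vadd_finset.1 hz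
      exact add_mem_add (mem_insert_self _ _) (mem_insert_of_mem hy)
  have := card_le_card hsub
  rw [card_union_of_disjoint hdisj, card_vadd_finset, hA'B'] at this
  omega

/-- **Lifting (17), general hole positions.**  Coarse data relative to `H` (quasi-periodic
decompositions `A = A₁ ∪ A'`, `B = B₁ ∪ B'` with (i), `|A + B| = |A| + |B|`, `|A' + B'| = |A'| + |B'|`,
`A', B' ≠ ∅`): (17) for `(A', B')` with ANY `α, β ∈ G` gives (17) for `(A, B)`.  Both holes inside
`A'`, `B'` contradict (iii); one inside is `seventeen_lift_of_mem`; both outside lie in the cosets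
(`sub_mem_of_seventeen`) and `seventeen_of_coarse` applies.
[cite: Grynkiewicz2009, §6 Claim 4 («it is readily checked …»)] -/
theorem seventeen_lift {H : AddSubgroup G} {A B A₁ A' B₁ B' : Finset G}
    (hdA : IsQuasiPeriodicDecomp H A A₁ A') (hdB : IsQuasiPeriodicDecomp H B B₁ B')
    (hA' : A'.Nonempty) (hB' : B'.Nonempty)
    (hi : ∀ a ∈ A, ∀ b ∈ B, ∀ x ∈ A', ∀ y ∈ B', (a + b) - (x + y) ∈ H → a - x ∈ H ∧ b - y ∈ H)
    (hAB : #(A + B) = #A + #B) (hA'B' : #(A' + B') = #A' + #B')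
    (h : ∃ α β : G, #(insert α A' + insert β B') + 1 = #(insert α A') + #(insert β B')) :
    ∃ α β : G, #(insert α A + insert β B) + 1 = #(insert α A) + #(insert β B) := by
  obtain ⟨α, β, h17⟩ := h
  have hBA : #(B + A) = #B + #A := by rw [add_comm, hAB, add_comm]
  have hB'A' : #(B' + A') = #B' + #A' := by rw [add_comm, hA'B', add_comm]
  have h17' : #(insert β B' + insert α A') + 1 = #(insert β B') + #(insert α A') := by
    rw [add_comm (insert β B'), add_comm #(insert β B')]; exact h17
  by_cases hα : α ∈ A'
  · by_cases hβ : β ∈ B'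
    · rw [insert_eq_of_mem hα, insert_eq_of_mem hβ] at h17; omega
    · exact ⟨α, β, seventeen_lift_of_mem hdA hdB hB' hAB hA'B' hα hβ h17⟩
  · by_cases hβ : β ∈ B'
    · have := seventeen_lift_of_mem hdB hdA hA' hBA hB'A' hβ hα h17'
      refine ⟨α, β, ?_⟩
      rw [add_comm (insert α A), add_comm #(insert α A)]; exact this
    · obtain ⟨a', ha'⟩ := hA'
      obtain ⟨b', hb'⟩ := hB'
      have h2B : 2 ≤ #B' := two_le_card_right ⟨b', hb'⟩ hA'B'
      have h2A : 2 ≤ #A' := two_le_card_right ⟨a', ha'⟩ hB'A'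
      have hαH : α - a' ∈ H :=
        sub_mem_of_seventeen hdA.sub_mem hdB.sub_mem h2B ha' hα hβ hA'B' h17
      have hβH : β - b' ∈ H :=
        sub_mem_of_seventeen hdB.sub_mem hdA.sub_mem h2A hb' hβ hα hB'A' h17'
      exact ⟨α, β, seventeen_of_coarse hdA hdB hi hAB hA'B' ha' hb' hαH hβH hα hβ h17⟩

/-! ### Lifting the decomposition: the general quasi-period -/

/-- **Lifting the decomposition, existence form.**  Coarse data relative to a finite `H` plus ANY
decomposition of Theorem 4.1 of the bottom pair give one of `(A, B)`: a nonempty periodic part of the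
bottom decomposition lies inside an `H`-coset, so its quasi-period `K` is `≤ H` and
`IsGrynkiewiczDecomp.lift` applies; if both periodic parts are empty the bottom pair is itself of type
(V)–(VIII) and the coarse data is the decomposition (`IsGrynkiewiczDecomp.of_coarse`).
[cite: Grynkiewicz2009, §6 Claim 4 («it is readily checked …»)] -/
theorem exists_isGrynkiewiczDecomp_of_coarse {K H : AddSubgroup G}
    {Hf A B A₁ A' B₁ B' A₁' A₀ B₁' B₀ : Finset G} (hHf : ∀ g, g ∈ Hf ↔ g ∈ H)
    (hdA : IsQuasiPeriodicDecomp H A A₁ A') (hdB : IsQuasiPeriodicDecomp H B B₁ B')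
    (hi : ∀ a ∈ A, ∀ b ∈ B, ∀ x ∈ A', ∀ y ∈ B', (a + b) - (x + y) ∈ H → a - x ∈ H ∧ b - y ∈ H)
    (hii : cosetCount H (A + B) + 1 = cosetCount H A + cosetCount H B)
    (hK : IsGrynkiewiczDecomp K A' B' A₁' A₀ B₁' B₀) :
    ∃ (L : AddSubgroup G) (X₁ X₀ Y₁ Y₀ : Finset G), IsGrynkiewiczDecomp L A B X₁ X₀ Y₁ Y₀ := by
  by_cases hne : A₁'.Nonempty ∨ B₁'.Nonempty
  · have hKH : K ≤ H := by
      rcases hne with hne | hne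
      · exact le_of_isQuasiPeriodicDecomp_of_sub_mem hK.decomp_left hdA.sub_mem hne
      · exact le_of_isQuasiPeriodicDecomp_of_sub_mem hK.decomp_right hdB.sub_mem hne
    exact ⟨K, _, _, _, _, hK.lift hKH hHf hdA hdB hi hii⟩
  · rw [not_or, not_nonempty_iff_eq_empty, not_nonempty_iff_eq_empty] at hne
    have hA₀ : A₀ = A' := by
      have := hK.decomp_left.union_eq; rwa [hne.1, empty_union] at this
    have hB₀ : B₀ = B' := by
      have := hK.decomp_right.union_eq; rwa [hne.2, empty_union] at this
    have hb := hK.bottom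
    have hA'ne := hK.left_nonempty
    have hB'ne := hK.right_nonempty
    rw [hA₀, hB₀] at hb
    rw [hA₀] at hA'ne
    rw [hB₀] at hB'ne
    exact ⟨H, A₁, A', B₁, B', IsGrynkiewiczDecomp.of_coarse hdA hdB hA'ne hB'ne hi hii hb⟩

/-- **«If Theorem 4.1 holds for the pair `(A₀, B₀)`, then Theorem 4.1 holds for the pair `(A, B)`»**
(first paragraph of Claim 4): coarse data relative to a finite `H` satisfying the conclusion of
Lemma 5.3 — quasi-periodic decompositions `A = A₁ ∪ A'`, `B = B₁ ∪ B'` with quasi-period `H`,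
`A', B' ≠ ∅`, (i), (ii), (iii) — and `|A + B| = |A| + |B|`; then the conclusion of Theorem 4.1
(first part) for `(A', B')` gives it for `(A, B)`. [cite: Grynkiewicz2009, §6 Claim 4] -/
theorem conclusion_of_coarse {H : AddSubgroup G} {Hf A B A₁ A' B₁ B' : Finset G}
    (hHf : ∀ g, g ∈ Hf ↔ g ∈ H)
    (hdA : IsQuasiPeriodicDecomp H A A₁ A') (hdB : IsQuasiPeriodicDecomp H B B₁ B')
    (hA' : A'.Nonempty) (hB' : B'.Nonempty)
    (hi : ∀ a ∈ A, ∀ b ∈ B, ∀ x ∈ A', ∀ y ∈ B', (a + b) - (x + y) ∈ H → a - x ∈ H ∧ b - y ∈ H)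
    (hii : cosetCount H (A + B) + 1 = cosetCount H A + cosetCount H B)
    (hAB : #(A + B) = #A + #B) (hA'B' : #(A' + B') = #A' + #B')
    (h : (∃ α β : G, #(insert α A' + insert β B') + 1 = #(insert α A') + #(insert β B')) ∨
      ∃ (K : AddSubgroup G) (A₁' A₀ B₁' B₀ : Finset G), IsGrynkiewiczDecomp K A' B' A₁' A₀ B₁' B₀) :
    (∃ α β : G, #(insert α A + insert β B) + 1 = #(insert α A) + #(insert β B)) ∨
      ∃ (K : AddSubgroup G) (X₁ X₀ Y₁ Y₀ : Finset G), IsGrynkiewiczDecomp K A B X₁ X₀ Y₁ Y₀ := by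
  rcases h with h | ⟨K, A₁', A₀, B₁', B₀, hK⟩
  · exact Or.inl (seventeen_lift hdA hdB hA' hB' hi hAB hA'B' h)
  · exact Or.inr (exists_isGrynkiewiczDecomp_of_coarse hHf hdA hdB hi hii hK)

/-! ### Claim 4, first half: it suffices to treat non-quasi-periodic summands -/

/-- **§6 Claim 4 (first half): «it suffices to prove Theorem 4.1 in the case both `A` and `B` are
non-quasi-periodic sets».**  If the conclusion of Theorem 4.1 (first part) — (17) or a decomposition
`IsGrynkiewiczDecomp` — holds for every pair of nonempty, mutually non-extendible,
NON-QUASI-PERIODIC finite sets `A, B ⊆ G` with `|A + B| = |A| + |B|` and `A + B` aperiodic, then it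
holds for every pair of nonempty finite sets `A, B ⊆ G` with `|A + B| = |A| + |B|` and `A + B`
aperiodic.  Proof (the printed reductions, iterated): strong induction on `|A| + |B|`; an extendible
pair satisfies (17) (`seventeen_of_insert_add_eq`); for a quasi-periodic `A` (resp. `B`, by
`conclusion_symm`) Lemma 5.3 (`exists_coarse_of_isQuasiPeriodic`) gives a bottom pair `(A₀, B₀)` with
`|A₀ + B₀| = |A₀| + |B₀|`, `A₀ + B₀` aperiodic (`not_isPeriodic_bottom_of_coarse`) and
`|A₀| + |B₀| < |A| + |B|`, whose conclusion (induction) lifts by `conclusion_of_coarse`.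
[cite: Grynkiewicz2009, §6 Claim 4 (proof of Thm 4.1, p. 24)] -/
theorem conclusion_of_forall_not_isQuasiPeriodic
    (core : ∀ A B : Finset G, A.Nonempty → B.Nonempty → #(A + B) = #A + #B →
      (A + B).addStab = {0} → IsNonExtendible A B → IsNonExtendible B A →
      ¬ IsQuasiPeriodic A → ¬ IsQuasiPeriodic B →
      ((∃ α β : G, #(insert α A + insert β B) + 1 = #(insert α A) + #(insert β B)) ∨
        ∃ (K : AddSubgroup G) (A₁ A₀ B₁ B₀ : Finset G), IsGrynkiewiczDecomp K A B A₁ A₀ B₁ B₀))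
    {A B : Finset G} (hA : A.Nonempty) (hB : B.Nonempty) (hAB : #(A + B) = #A + #B)
    (haper : (A + B).addStab = {0}) :
    (∃ α β : G, #(insert α A + insert β B) + 1 = #(insert α A) + #(insert β B)) ∨
      ∃ (K : AddSubgroup G) (A₁ A₀ B₁ B₀ : Finset G), IsGrynkiewiczDecomp K A B A₁ A₀ B₁ B₀ := by
  suffices key : ∀ n : ℕ, ∀ A B : Finset G, #A + #B = n → A.Nonempty → B.Nonempty →
      #(A + B) = #A + #B → (A + B).addStab = {0} →
      ((∃ α β : G, #(insert α A + insert β B) + 1 = #(insert α A) + #(insert β B)) ∨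
        ∃ (K : AddSubgroup G) (A₁ A₀ B₁ B₀ : Finset G), IsGrynkiewiczDecomp K A B A₁ A₀ B₁ B₀) from
    key _ A B rfl hA hB hAB haper
  intro n
  refine Nat.strong_induction_on n ?_
  intro n ih
  -- a quasi-periodic first summand: Lemma 5.3, induction, lift
  have step : ∀ A B : Finset G, #A + #B = n → A.Nonempty → B.Nonempty → #(A + B) = #A + #B →
      (A + B).addStab = {0} → IsNonExtendible A B → IsNonExtendible B A → IsQuasiPeriodic A →
      ((∃ α β : G, #(insert α A + insert β B) + 1 = #(insert α A) + #(insert β B)) ∨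
        ∃ (K : AddSubgroup G) (A₁ A₀ B₁ B₀ : Finset G), IsGrynkiewiczDecomp K A B A₁ A₀ B₁ B₀) := by
    intro A B hn hA hB hAB haper hneA hneB hAqp
    obtain ⟨H, Hf, A₁, A', B₁, B', hHf, hdA, hdB, hA₁, hA', hB', hiii, hi, hii⟩ :=
      exists_coarse_of_isQuasiPeriodic hAqp hB hAB haper hneA hneB
    have hlt : #A' + #B' < n := by
      rw [← hn, hdA.card_eq, hdB.card_eq]; have := hA₁.card_pos; omega
    have haper' : (A' + B').addStab = {0} := by
      have hnp : ¬ IsPeriodic (A + B) := fun h => (isPeriodic_iff_addStab_ne (hA.add hB)).1 h haper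
      have := not_isPeriodic_bottom_of_coarse hdA hdB hA' hB' hnp
      by_contra hne
      exact this ((isPeriodic_iff_addStab_ne (hA'.add hB')).2 hne)
    have hbot := ih _ hlt A' B' rfl hA' hB' hiii haper'
    exact conclusion_of_coarse hHf hdA hdB hA' hB' hi hii hAB hiii hbot
  intro A B hn hA hB hAB haper
  -- extendible pairs satisfy (17)
  by_cases hneA : IsNonExtendible A B
  swap
  · unfold IsNonExtendible at hneA
    push Not at hneA
    obtain ⟨a, ha, heq⟩ := hneA
    exact Or.inl (seventeen_of_insert_add_eq ha heq hB hAB)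
  by_cases hneB : IsNonExtendible B A
  swap
  · unfold IsNonExtendible at hneB
    push Not at hneB
    obtain ⟨b, hb, heq⟩ := hneB
    rw [add_comm, add_comm B] at heq
    exact Or.inl (seventeen_of_add_insert_eq hb heq hA hAB)
  by_cases hAqp : IsQuasiPeriodic A
  · exact step A B hn hA hB hAB haper hneA hneB hAqp
  by_cases hBqp : IsQuasiPeriodic B
  · have hBA : #(B + A) = #B + #A := by rw [add_comm, hAB, add_comm]
    have haper' : (B + A).addStab = {0} := by rwa [add_comm]
    exact conclusion_symm (step B A (by omega) hB hA hBA haper' hneB hneA hBqp)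
  exact core A B hA hB hAB haper hneA hneB hAqp hBqp

end Grynkiewicz2009

end Literature.Combinatorics.Additive
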